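import Literature.AlgebraicGeometry.Frobenioids.FinSubextCatAut
import Literature.AlgebraicGeometry.Frobenioids.BaseCategoryTheoreticityDefs
import HarnessLib

/-!
# Frobenioids I, §6: `D = B(G)⁰` is Frobenius-slim — PROOF (Theorem 6.2 (iv), first assertion;
# Theorem 6.4 (i), "`D` is Frobenius-slim")

Mochizuki, *The geometry of Frobenioids I*, kurims p. 111 (Thm. 6.2 (iv): "`D` is Frobenius-slim"), p. 114
(Thm. 6.4 (i)), proof p. 112: "Since `G` is profinite, hence, in particular, residually finite, it follows
formally that `Z`, `Z_G(H)` [`≅ Aut(D_{Spec(L)} → D)`] are also residually finite, hence that `D` is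
Frobenius-slim, by Remark 3.1.2." [cite: MochizukiFrdI2008, Thm. 6.2 (iv) p.111]

PROOF-ONLY companion (abc-iut-L6-t10, D-ζ-c): the residual finiteness of `Aut(D_A → D)`
(`FinSubextCatAut.lean`, any field extension `K/F`) in the named forms of abc-iut-L1-t3's
`BaseCategoryTheoreticityDefs.lean` (`IsResiduallyFiniteGroup`, Rem. 3.1.2
`isFrobeniusSlim_of_residuallyFinite`, Def. 3.1 (i) `IsFrobeniusSlim`).
-/

namespace Literature.AlgebraicGeometry.Frobenioids

open CategoryTheory

universe u

namespace FinSubextCat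

variable {F : Type u} [Field F] {K : Type u} [Field K] [Algebra F K]

/-- `Aut(D_A → D)` is residually finite, for `D = FinSubextCat F K` and any extension `K/F` (FrdI p. 112).
[cite: MochizukiFrdI2008, Thm. 6.2 (iv) p.112] -/
theorem isResiduallyFiniteGroup_aut_forget (A : FinSubextCat F K) :
    IsResiduallyFiniteGroup (Aut (Over.forget A)) :=
  fun α hα => exists_normal_finiteIndex_not_mem A α hα

variable (F K) in
/-- **Theorem 6.2 (iv), first assertion / Theorem 6.4 (i)** "`D` is Frobenius-slim" — PROVED for every field
extension `K/F` (FrdI p. 111, p. 114; proof p. 112 via Rem. 3.1.2). [cite: MochizukiFrdI2008, Thm. 6.2 (iv) p.111] -/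
theorem isFrobeniusSlim : IsFrobeniusSlim (FinSubextCat F K) :=
  isFrobeniusSlim_of_residuallyFinite isResiduallyFiniteGroup_aut_forget

end FinSubextCat

end Literature.AlgebraicGeometry.Frobenioids
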